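import Summits.QuantumFields.YangMills.Theorems.UnitScaleTiltProp7CurvedLandauCoreFinalT3
import Summits.QuantumFields.YangMills.Theorems.UnitScaleTiltProp7CurvedLandauRowA
import Summits.QuantumFields.YangMills.Theorems.UnitScaleTiltProp7LineIterVsEngineOfTower
import HarnessLib

/-!
# Route `UnitScaleTilt`, crux K1 «MinimiserStabilityRegPr» (stmt-QuantumFields-19200), lane α-P (RULING №30 (2)) — THE LINEARISED SUBSPACE CORE AT A (14)-REGULAR
# BACKGROUND: for a bond field `Y` with `Q^{(K−n)}_{U₀}Y = 0` (true linearised fibre tangent) and `D^*_{U₀}Y = 0` (covariant Landau),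
# `(1∕2)·ℓ⁻²·Σ_b‖Y(b)‖² ≤ (18 + 76800L⁴)·Σ_{x,μ<ν}‖curl_{U₀}Y(x)_{μν}‖²_HS` — k- and volume-UNIFORM (`2·10¹³L⁹ε ≤ 1`)

Cell `ym3-torus`, D-0154 (3c) twin-width seat `ym-routeR-w3` (gen 2); corollary of ✓ p622368 `Prop7CurvedLandauCoreFinalT3.sum_normSq_le_curl_sq_core_T3` (generic `Y`,
budgets `(δ, Z, Z_Q)`) at `δ = Z = Z_Q = 0`, with the reduced∕line∕gauge families `G, S, Λ` instantiated (✓ `exists_reduced_family` ∕ `exists_pureLine_family` ∕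
`exists_coarseGauge_family`).  THEOREMS ONLY (0 `def`, 0 `sorry`); `--supports stmt-QuantumFields-19200`, count-neutral.  YM₃ on T³ is a ladder rung (R3), not the Clay
problem; nothing here claims the stub, the crux, d = 4 or the mass gap.

THE POINT.  ★p1 g12's VERDICT (Λ) (CARD-19200-V3 #47) and RULING №30: the chart-free route-R schema is retired (soft mode `lqP ≈ 2.2ε²` on Landau-PROJECTED fibre tangents),
while the SUBSPACE `{QY = 0, D^*Y = 0}` and print's slice `{RD^*Y = 0, QY = 0}` are numerically COERCIVE (26.4∕24.5∕20.0); lane α-P's HESS_W row asks for exactly such a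
coercivity at the critical background.  This file is the kernel form of the LINEARISED SUBSPACE statement at ANY (14)-regular background `U₀` (in particular the critical
`W` of the EX knit, which is (14)-regular by `RegPr`): no competitor, no fibre identity, no sup — a bond field `Y` annihilated by the top-level true linearised average
`Q^{(K−n)}_{U₀}` and by the covariant divergence.  The true linearised iterate `Q` stays displayed (the hypothesis `Q^{(K−n)}Y = 0` mentions it; zero content:
✓ `exists_trueLinIter_family`).  What this is NOT: print's slice (`IsLandauPrint` = (1.38) in multiplier form `Δ_{U₀}(D^*A) = Q′ᵀμ`, `AvgCondPrint` = restricted-gauge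
equivalence to the fibre) — the dictionary from print's slice to this subspace, and `q_W`'s first term vs `CURL_HS`, are the HESS_W row's remaining content.

WHAT IS PROVED (ns `…Theorems.Prop7CurvedLandauCoreLinearSubspaceT3`): ★★ `linearised_subspace_core_T3`; ★★ `linearised_subspace_core_budget_T3` (divergence budget
`(δ, Z)` and constraint budget `Z_Q` kept, families instantiated: `((1∕2)ℓ⁻² − Aδ)Σ‖Y‖² − AZ − 96ℓ⁻¹Z_Q ≤ A·CURL_HS`, `A = 18 + 76800L⁴`).
HONEST SCOPE.  Two `obtain`s and an `exact`∕`linarith`; the mathematics is ✓ p622368's chain (S2′ knit, (R-A)∕(R-B)∕(R-C), ★routeR-w2's `(H¹)^*` row).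

References: T. Bałaban, CMP 99 (1985) 389–434 [Balaban1985BackgroundPropagators] (Thm 3.11 p.416); CMP 102 (1985) 277–309 [Balaban1985Variational] ((14)–(15) p.280,
Prop. 7 p.299); CMP 98 (1985) 17–51 [Balaban1985Averaging] (Prop. 3 (122)–(126) p.36).
-/

set_option autoImplicit false

noncomputable section

open scoped BigOperators Matrix.Norms.L2Operator Matrix

namespace Summit.QuantumFields.YangMills.Theorems.Prop7CurvedLandauCoreLinearSubspaceT3

open Literature.MathematicalPhysics.QuantumFieldTheory.Balaban1983to89
open Literature.MathematicalPhysics.QuantumFieldTheory.Balaban1983to89.T3ContinuumYM3Torus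
open Finset T4Continuum T4ReflectionCone BlockAveraging AveragingRT ExpMeanLog BlockAveragingEMLLinearised BlockAveragingEMLLinearisedBackground
  BlockAveragingEMLProp2 B1RG242Torus
open B9Eq39Adjoint (curl divB)
open B10Eq27TorusAxialLog (holT unitsField toUField)
open B9TorusCalculus (torusT)
open Summit.QuantumFields.YangMills.Theorems.Prop7CurvedLandauKnitT3 (three_le_L)
open Summit.QuantumFields.YangMills.Theorems.Prop7CurvedLandauRowA (exists_reduced_family exists_coarseGauge_family)
open Summit.QuantumFields.YangMills.Theorems.Prop7LineIterVsEngineOfTower (exists_pureLine_family)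
open Summit.QuantumFields.YangMills.Theorems.Prop7CurvedLandauCoreFinalT3 (sum_normSq_le_curl_sq_core_T3)

set_option maxHeartbeats 400000 in
/-- ★★ **THE LINEARISED CORE WITH BUDGETS, FAMILIES INSTANTIATED (d = 3, `SU(2)`).**  `U₀` (14)-regular at scale `ℓ = L^{K−n}` (`2·10¹³L⁹ε ≤ 1`); `Y` any bond field;
`Q` the true linearised iterate of record (displayed; zero content); budgets `Σ‖D^*_{U₀}Y‖²_HS ≤ δΣ‖Y‖² + Z`, `Σ_c‖Q^{(K−n)}Y(c)‖² ≤ Z_Q`.  THEN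
`((1∕2)ℓ⁻² − (18 + 76800L⁴)δ)Σ‖Y‖² − (18 + 76800L⁴)Z − 96ℓ⁻¹Z_Q ≤ (18 + 76800L⁴)·Σ‖curl_{U₀}Y‖²_HS`.
[cite: Balaban1985BackgroundPropagators, Thm 3.11 p.416; Balaban1985Variational, (14)-(15) p.280, Prop. 7 p.299] -/
theorem linearised_subspace_core_budget_T3 (F : T3Family) (n K : ℕ)
    (U₀ : GaugeField (F.P K) 0 (Matrix.specialUnitaryGroup (Fin 2) ℂ)) {ε : ℝ} (hε : 0 < ε) (hεL : 20000000000000 * (F.L : ℝ) ^ 9 * ε ≤ 1)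
    (hU : ∀ p : Plaq (F.P K) 0, dist1 (GaugeField.plaqHol U₀ p) ≤ ε * (((F.L : ℝ) ^ (K - n)) ^ 2)⁻¹)
    (Q : (k : ℕ) → (PBond (F.P K) 0 → Matrix (Fin 2) (Fin 2) ℂ) → PBond (F.P K) k → Matrix (Fin 2) (Fin 2) ℂ) (hQ0 : ∀ Y, Q 0 Y = Y)
    (hQs : ∀ (k : ℕ) (Y : PBond (F.P K) 0 → Matrix (Fin 2) (Fin 2) ℂ) (c : PBond (F.P K) (k + 1)), Q (k + 1) Y c
      = (fderiv ℂ (eml : (Idx (F.P K) → Matrix (Fin 2) (Fin 2) ℂ) → Matrix (Fin 2) (Fin 2) ℂ)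
            (fun i => ((loopHol (Averaging.iter (fun i => blockAvg (P := (F.P K)) (j := i) (expMeanLogSU (n := Fin 2))) k U₀) c i : Matrix.specialUnitaryGroup (Fin 2) ℂ) : Matrix (Fin 2) (Fin 2) ℂ))
            (fun i => covWalkSum (Averaging.iter (fun i => blockAvg (P := (F.P K)) (j := i) (expMeanLogSU (n := Fin 2))) k U₀) (Q k Y) (walk (emb c.src) (loopWord (F.P K).L c.dir (off i.1) i.2.1 i.2.2))
              * ((loopHol (Averaging.iter (fun i => blockAvg (P := (F.P K)) (j := i) (expMeanLogSU (n := Fin 2))) k U₀) c i : Matrix.specialUnitaryGroup (Fin 2) ℂ) : Matrix (Fin 2) (Fin 2) ℂ))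
            * star ((corr (expMeanLogSU (n := Fin 2)) (Averaging.iter (fun i => blockAvg (P := (F.P K)) (j := i) (expMeanLogSU (n := Fin 2))) k U₀) c : Matrix.specialUnitaryGroup (Fin 2) ℂ) : Matrix (Fin 2) (Fin 2) ℂ)
          + ((corr (expMeanLogSU (n := Fin 2)) (Averaging.iter (fun i => blockAvg (P := (F.P K)) (j := i) (expMeanLogSU (n := Fin 2))) k U₀) c : Matrix.specialUnitaryGroup (Fin 2) ℂ) : Matrix (Fin 2) (Fin 2) ℂ)
            * covWalkSum (Averaging.iter (fun i => blockAvg (P := (F.P K)) (j := i) (expMeanLogSU (n := Fin 2))) k U₀) (Q k Y) (walk (emb c.src) (List.replicate (F.P K).L (c.dir, true)))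
            * star ((corr (expMeanLogSU (n := Fin 2)) (Averaging.iter (fun i => blockAvg (P := (F.P K)) (j := i) (expMeanLogSU (n := Fin 2))) k U₀) c : Matrix.specialUnitaryGroup (Fin 2) ℂ) : Matrix (Fin 2) (Fin 2) ℂ)))
    (Y : PBond (F.P K) 0 → Matrix (Fin 2) (Fin 2) ℂ)
    {δ Z : ℝ}
    (hdivB : (∑ x : Site (F.P K) 0, ∑ j : Fin 2, ∑ k : Fin 2,
            ‖(divB (torusT (F.P K) 0) (fun κ z => unitsField (toUField U₀) ⟨z, κ⟩) (fun κ z => Y ⟨z, κ⟩) x) j k‖ ^ 2)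
      ≤ δ * (∑ b : PBond (F.P K) 0, ‖Y b‖ ^ 2) + Z)
    {ZQ : ℝ} (hQ : ∑ c : PBond (F.P K) (K - n), ‖Q (K - n) Y c‖ ^ 2 ≤ ZQ) :
    ((1 / 2) * ((((F.L : ℝ) ^ (K - n))) ^ 2)⁻¹ - (18 + 76800 * (F.L : ℝ) ^ 4) * δ) * (∑ b : PBond (F.P K) 0, ‖Y b‖ ^ 2) - (18 + 76800 * (F.L : ℝ) ^ 4) * Z - 96 * (((F.L : ℝ) ^ (K - n)))⁻¹ * ZQ
      ≤ (18 + 76800 * (F.L : ℝ) ^ 4) * (∑ x : Site (F.P K) 0, ∑ μ : Fin (F.P K).d, ∑ ν : Fin (F.P K).d,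
            (if μ < ν then ∑ j : Fin 2, ∑ k : Fin 2,
              ‖(curl (torusT (F.P K) 0) (fun κ z => unitsField (toUField U₀) ⟨z, κ⟩) (fun κ z => Y ⟨z, κ⟩) μ ν x) j k‖ ^ 2 else 0)) := by
  obtain ⟨G, hG0, hGs⟩ := exists_reduced_family (N := 2) U₀ Y
  obtain ⟨Λ, hΛ0, hΛs⟩ := exists_coarseGauge_family (N := 2) U₀ G
  obtain ⟨S, hS0, hSs⟩ := exists_pureLine_family U₀ Y
  exact sum_normSq_le_curl_sq_core_T3 F n K U₀ hε hεL hU Q hQ0 hQs Y G S Λ hG0 hS0 hΛ0 hΛs hGs hSs hdivB hQ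

set_option maxHeartbeats 400000 in
/-- ★★ **THE LINEARISED SUBSPACE CORE (d = 3, `SU(2)`).**  `U₀` (14)-regular at scale `ℓ = L^{K−n}` (`2·10¹³L⁹ε ≤ 1`); `Y` a bond field with `Q^{(K−n)}_{U₀}Y = 0`
(true linearised fibre tangent; `Q` displayed, zero content) and `D^*_{U₀}Y = 0` pointwise (covariant Landau).  THEN
`(1∕2)·ℓ⁻²·Σ_b‖Y(b)‖² ≤ (18 + 76800L⁴)·Σ_{x,μ<ν}‖curl_{U₀}Y(x)_{μν}‖²_HS` — the subspace `{QY = 0, D^*Y = 0}` is coercive with a k- and volume-uniform constant.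
[cite: Balaban1985BackgroundPropagators, Thm 3.11 p.416; Balaban1985Variational, (14)-(15) p.280, Prop. 7 p.299] -/
theorem linearised_subspace_core_T3 (F : T3Family) (n K : ℕ)
    (U₀ : GaugeField (F.P K) 0 (Matrix.specialUnitaryGroup (Fin 2) ℂ)) {ε : ℝ} (hε : 0 < ε) (hεL : 20000000000000 * (F.L : ℝ) ^ 9 * ε ≤ 1)
    (hU : ∀ p : Plaq (F.P K) 0, dist1 (GaugeField.plaqHol U₀ p) ≤ ε * (((F.L : ℝ) ^ (K - n)) ^ 2)⁻¹)
    (Q : (k : ℕ) → (PBond (F.P K) 0 → Matrix (Fin 2) (Fin 2) ℂ) → PBond (F.P K) k → Matrix (Fin 2) (Fin 2) ℂ) (hQ0 : ∀ Y, Q 0 Y = Y)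
    (hQs : ∀ (k : ℕ) (Y : PBond (F.P K) 0 → Matrix (Fin 2) (Fin 2) ℂ) (c : PBond (F.P K) (k + 1)), Q (k + 1) Y c
      = (fderiv ℂ (eml : (Idx (F.P K) → Matrix (Fin 2) (Fin 2) ℂ) → Matrix (Fin 2) (Fin 2) ℂ)
            (fun i => ((loopHol (Averaging.iter (fun i => blockAvg (P := (F.P K)) (j := i) (expMeanLogSU (n := Fin 2))) k U₀) c i : Matrix.specialUnitaryGroup (Fin 2) ℂ) : Matrix (Fin 2) (Fin 2) ℂ))
            (fun i => covWalkSum (Averaging.iter (fun i => blockAvg (P := (F.P K)) (j := i) (expMeanLogSU (n := Fin 2))) k U₀) (Q k Y) (walk (emb c.src) (loopWord (F.P K).L c.dir (off i.1) i.2.1 i.2.2))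
              * ((loopHol (Averaging.iter (fun i => blockAvg (P := (F.P K)) (j := i) (expMeanLogSU (n := Fin 2))) k U₀) c i : Matrix.specialUnitaryGroup (Fin 2) ℂ) : Matrix (Fin 2) (Fin 2) ℂ))
            * star ((corr (expMeanLogSU (n := Fin 2)) (Averaging.iter (fun i => blockAvg (P := (F.P K)) (j := i) (expMeanLogSU (n := Fin 2))) k U₀) c : Matrix.specialUnitaryGroup (Fin 2) ℂ) : Matrix (Fin 2) (Fin 2) ℂ)
          + ((corr (expMeanLogSU (n := Fin 2)) (Averaging.iter (fun i => blockAvg (P := (F.P K)) (j := i) (expMeanLogSU (n := Fin 2))) k U₀) c : Matrix.specialUnitaryGroup (Fin 2) ℂ) : Matrix (Fin 2) (Fin 2) ℂ)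
            * covWalkSum (Averaging.iter (fun i => blockAvg (P := (F.P K)) (j := i) (expMeanLogSU (n := Fin 2))) k U₀) (Q k Y) (walk (emb c.src) (List.replicate (F.P K).L (c.dir, true)))
            * star ((corr (expMeanLogSU (n := Fin 2)) (Averaging.iter (fun i => blockAvg (P := (F.P K)) (j := i) (expMeanLogSU (n := Fin 2))) k U₀) c : Matrix.specialUnitaryGroup (Fin 2) ℂ) : Matrix (Fin 2) (Fin 2) ℂ)))
    (Y : PBond (F.P K) 0 → Matrix (Fin 2) (Fin 2) ℂ)
    (hQY : ∀ c : PBond (F.P K) (K - n), Q (K - n) Y c = 0)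
    (hLandau : ∀ x : Site (F.P K) 0, divB (torusT (F.P K) 0) (fun κ z => unitsField (toUField U₀) ⟨z, κ⟩) (fun κ z => Y ⟨z, κ⟩) x = 0) :
    (1 / 2) * ((((F.L : ℝ) ^ (K - n))) ^ 2)⁻¹ * (∑ b : PBond (F.P K) 0, ‖Y b‖ ^ 2)
      ≤ (18 + 76800 * (F.L : ℝ) ^ 4) * (∑ x : Site (F.P K) 0, ∑ μ : Fin (F.P K).d, ∑ ν : Fin (F.P K).d,
            (if μ < ν then ∑ j : Fin 2, ∑ k : Fin 2,
              ‖(curl (torusT (F.P K) 0) (fun κ z => unitsField (toUField U₀) ⟨z, κ⟩) (fun κ z => Y ⟨z, κ⟩) μ ν x) j k‖ ^ 2 else 0)) := by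
  have hz : (∑ x : Site (F.P K) 0, ∑ j : Fin 2, ∑ k : Fin 2,
            ‖(divB (torusT (F.P K) 0) (fun κ z => unitsField (toUField U₀) ⟨z, κ⟩) (fun κ z => Y ⟨z, κ⟩) x) j k‖ ^ 2) = 0 := by
    refine Finset.sum_eq_zero fun x _ => ?_
    rw [hLandau x]
    simp
  have hdivB : (∑ x : Site (F.P K) 0, ∑ j : Fin 2, ∑ k : Fin 2,
            ‖(divB (torusT (F.P K) 0) (fun κ z => unitsField (toUField U₀) ⟨z, κ⟩) (fun κ z => Y ⟨z, κ⟩) x) j k‖ ^ 2)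
      ≤ 0 * (∑ b : PBond (F.P K) 0, ‖Y b‖ ^ 2) + 0 := by
    rw [hz, zero_mul, add_zero]
  have hq0 : ∑ c : PBond (F.P K) (K - n), ‖Q (K - n) Y c‖ ^ 2 ≤ 0 := by
    rw [Finset.sum_eq_zero fun c _ => by rw [hQY c, norm_zero, zero_pow two_ne_zero]]
  have h := linearised_subspace_core_budget_T3 F n K U₀ hε hεL hU Q hQ0 hQs Y hdivB hq0
  linarith only [h]

end Summit.QuantumFields.YangMills.Theorems.Prop7CurvedLandauCoreLinearSubspaceT3

end
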